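import Mathlib.Tactic
import HarnessLib

/-!
# Kozma–Nitzan's Question 8 at three relays — polynomial cores of the universal k = 3 step (gen 32)

Support file (`--supports stmt-CriticalPhenomena-4575`, closed crux; independent mathematics on Kozma–Nitzan's Question 8,
arXiv:2401.12397 §5.5 p. 36), prover `prim-ineq-gen-6` (gen 32).  No definitions, no named facts, no sorries; standard axioms.
Memo `run/shared/lean/prim/prim-ineq-gen-6/PROOF-RCG3-G32.md` §4.

The reduced k = 3 problem (RC-G3) of the merge induction (FINDING-G31 §5g) is reduced in the memo to two observers acting on the
single class `{b₂}` of `T₂`; after the vertex-1 A-defect part (INEQ-A), the prefix part of the excess need (paid by the L-kill) and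
the normalisations `P_F ≤ 1`, `s ≤ 1`, `M₁ ≥ C`, `A ≤ 1`, `a`-elimination, what is left is a convex function of the far A-only
density `v̂` whose value and slope at the marginal point `v̂₀ = λ′₂(1−û)/(1+λ′₂)` are controlled by the four polynomial facts below
(variables: `λ ∈ (0,1)`, `q = 1/(1+λ)`, `K₁ = ¾ − λ(1−λ)`, the prefix C-defect `d = 1 − c ≤ λ/(1+λ)`, the far A-bad share
`y = û ∈ [0,1]`, the good far factor `P ∈ [c,1]`).  All four are multiplied through by `1+λ`.
[cite: KozmaNitzan2024, Question 8 (§5.5 p. 36)]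
-/

namespace Summit.CriticalPhenomena.PercolationContinuityZ3.Theorems

namespace PocketCert

/-- **Core φ** (the value condition at `C₁ = 1`): for `0 < λ < 1`, `d(1+λ) ≤ λ`, `0 ≤ y ≤ 1`,
`(1+λ)(1−dy)(¾ − λ(1−λ)) ≥ (1−y)·λ·(λ + dy)`.
[cite: KozmaNitzan2024, Question 8 (§5.5 p. 36)] -/
theorem k3_phi_core (lam d y : ℝ) (hl0 : 0 < lam) (hl1 : lam < 1) (hd1 : d * (1 + lam) ≤ lam)
    (hy0 : 0 ≤ y) (hy1 : y ≤ 1) :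
    (1 - y) * lam * (lam + d * y) ≤ (1 + lam) * (1 - d * y) * (3 / 4 - lam * (1 - lam)) := by
  -- the claim is decreasing in d; at d = λ/(1+λ) it is a convex parabola in y with nonnegative minimum:
  -- (1+λ)·(RHS − LHS) = y(λ − (1+λ)d)((1+λ)K + λ(1−y)) + (λy − G/2)² + G(1+λ−G/4),  K = ¾ − λ(1−λ), G = (1+λ)K − λ².
  set K := 3 / 4 - lam * (1 - lam) with hK
  set G := (1 + lam) * K - lam ^ 2 with hG
  have hK0 : 1 / 2 ≤ K := by rw [hK]; nlinarith [sq_nonneg (lam - 1 / 2)]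
  have hG0 : 0 ≤ G := by
    -- G = 3/4 − λ/4 − λ²(1−λ) and λ²(1−λ) ≤ 4/27
    have h1 : G = 3 / 4 - lam / 4 - lam ^ 2 * (1 - lam) := by rw [hG, hK]; ring
    have h2 : lam ^ 2 * (1 - lam) ≤ 4 / 27 := by nlinarith [mul_nonneg (sq_nonneg (lam - 2 / 3)) (by linarith : (0:ℝ) ≤ lam + 1 / 3)]
    rw [h1]; nlinarith
  have hG1 : G ≤ 2 := by
    have h1 : G = 3 / 4 - lam / 4 - lam ^ 2 * (1 - lam) := by rw [hG, hK]; ring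
    rw [h1]; nlinarith [mul_nonneg (sq_nonneg lam) (sub_pos.mpr hl1).le]
  have key : (1 + lam) * ((1 + lam) * (1 - d * y) * K - (1 - y) * lam * (lam + d * y))
      = y * (lam - (1 + lam) * d) * ((1 + lam) * K + lam * (1 - y)) + (lam * y - G / 2) ^ 2 + G * (1 + lam - G / 4) := by
    rw [hG]; ring
  have t1 : 0 ≤ y * (lam - (1 + lam) * d) * ((1 + lam) * K + lam * (1 - y)) := by
    apply mul_nonneg (mul_nonneg hy0 (by nlinarith)) ; nlinarith
  have t2 : 0 ≤ (lam * y - G / 2) ^ 2 := sq_nonneg _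
  have t3 : 0 ≤ G * (1 + lam - G / 4) := mul_nonneg hG0 (by nlinarith)
  have hpos : (0:ℝ) < 1 + lam := by linarith
  have : 0 ≤ (1 + lam) * ((1 + lam) * (1 - d * y) * K - (1 - y) * lam * (lam + d * y)) := by rw [key]; linarith
  have h2 : 0 ≤ (1 + lam) * (1 - d * y) * K - (1 - y) * lam * (lam + d * y) := by
    by_contra hneg; push Not at hneg
    have := mul_neg_of_pos_of_neg hpos hneg; linarith
  linarith

/-- **Core ψ** (the value condition at the smallest admissible `C₁`, i.e. `λ′₂ = 0`): for `0 < λ < 1`, `0 ≤ d`,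
`d(1+λ) ≤ λ`, `0 ≤ y ≤ 1`,
`(1+λ)(1−d)(1−dy)(¾ − λ(1−λ)) ≥ (1−y)·d·(λ + dy) + λ·((1+λ)(1−d) − 1)`.
[cite: KozmaNitzan2024, Question 8 (§5.5 p. 36)] -/
theorem k3_psi_core (lam d y : ℝ) (hl0 : 0 < lam) (hl1 : lam < 1) (hd0 : 0 ≤ d) (hd1 : d * (1 + lam) ≤ lam)
    (hy0 : 0 ≤ y) (hy1 : y ≤ 1) :
    (1 - y) * d * (lam + d * y) + lam * ((1 + lam) * (1 - d) - 1)
      ≤ (1 + lam) * (1 - d) * (1 - d * y) * (3 / 4 - lam * (1 - lam)) := by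
  nlinarith [mul_nonneg hd0 hy0, mul_nonneg hd0 (sub_nonneg.mpr hy1), mul_nonneg hy0 (sub_nonneg.mpr hy1),
    mul_nonneg (sub_nonneg.mpr hd1) hy0, mul_nonneg (sub_nonneg.mpr hd1) (sub_nonneg.mpr hy1),
    mul_nonneg (mul_nonneg hd0 hy0) (sub_nonneg.mpr hy1), mul_nonneg (mul_nonneg hd0 hy0) hy0,
    mul_pos hl0 (sub_pos.mpr hl1), sq_nonneg (lam - 1 / 2), sq_nonneg (y - 1 / 2), sq_nonneg (d * y),
    mul_nonneg (mul_nonneg (sub_nonneg.mpr hd1) hy0) (sub_nonneg.mpr hy1), mul_nonneg hd0 (sub_nonneg.mpr hd1),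
    mul_nonneg (mul_nonneg hd0 (sub_nonneg.mpr hd1)) hy0, mul_nonneg (mul_nonneg hd0 hd0) hy0,
    mul_nonneg (mul_nonneg (sub_nonneg.mpr hd1) hy0) hy0]

/-- **Core b1** (the slope condition at `C₁ = 1`): for `0 < λ < 1`, `(1+λ)c ≥ 1`, `c ≤ P ≤ 1`,
`(1+λ)·P·(¾ − λ(1−λ)) ≥ ((1+λ)c − 1)·((1+λ) − 2P)`.
[cite: KozmaNitzan2024, Question 8 (§5.5 p. 36)] -/
theorem k3_b1_core (lam c P : ℝ) (hl0 : 0 < lam) (hl1 : lam < 1) (hc0 : 1 ≤ (1 + lam) * c) (hcP : c ≤ P) (hP1 : P ≤ 1) :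
    ((1 + lam) * c - 1) * ((1 + lam) - 2 * P) ≤ (1 + lam) * P * (3 / 4 - lam * (1 - lam)) := by
  rcases le_or_gt ((1 + lam) - 2 * P) 0 with hneg | hpos
  · -- the left side is ≤ 0 ≤ the right side
    have h1 : ((1 + lam) * c - 1) * ((1 + lam) - 2 * P) ≤ 0 :=
      mul_nonpos_of_nonneg_of_nonpos (by linarith) hneg
    have h2 : 0 ≤ (1 + lam) * P * (3 / 4 - lam * (1 - lam)) := by
      have hK : 0 ≤ 3 / 4 - lam * (1 - lam) := by nlinarith [sq_nonneg (lam - 1 / 2)]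
      have hP : 0 ≤ P := by nlinarith
      positivity
    linarith
  · -- replace c by P (monotone), then J = (1+λ)(2P² − 9P/4 + 1) + λ²(λ−1)P ≥ 47(1+λ)/128 − 4/27 ≥ 0
    have h1 : ((1 + lam) * c - 1) * ((1 + lam) - 2 * P) ≤ ((1 + lam) * P - 1) * ((1 + lam) - 2 * P) := by
      apply mul_le_mul_of_nonneg_right _ hpos.le; nlinarith
    have key : (1 + lam) * P * (3 / 4 - lam * (1 - lam)) - ((1 + lam) * P - 1) * ((1 + lam) - 2 * P)
        = (1 + lam) * (2 * (P - 9 / 16) ^ 2 + 47 / 128) - lam ^ 2 * (1 - lam) * P := by ring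
    have h2 : lam ^ 2 * (1 - lam) ≤ 4 / 27 := by
      nlinarith [mul_nonneg (sq_nonneg (lam - 2 / 3)) (by linarith : (0:ℝ) ≤ lam + 1 / 3)]
    have hP0 : 0 ≤ P := by nlinarith
    have h3 : lam ^ 2 * (1 - lam) * P ≤ 4 / 27 := by
      calc lam ^ 2 * (1 - lam) * P ≤ lam ^ 2 * (1 - lam) * 1 :=
            mul_le_mul_of_nonneg_left hP1 (by nlinarith [sq_nonneg lam])
        _ ≤ 4 / 27 := by linarith
    have h4 : 47 / 128 ≤ (1 + lam) * (2 * (P - 9 / 16) ^ 2 + 47 / 128) := by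
      nlinarith [sq_nonneg (P - 9 / 16), mul_nonneg hl0.le (sq_nonneg (P - 9 / 16))]
    nlinarith [key, h1, h3, h4]

/-- **Core b2** (the slope condition at the smallest admissible `C₁`): for `0 < λ < 1`, `(1+λ)c ≥ 1`, `c ≤ 1`,
`(1+λ)·c²·(¾ − λ(1−λ)) ≥ λ·((1+λ)c − 1)`.
[cite: KozmaNitzan2024, Question 8 (§5.5 p. 36)] -/
theorem k3_b2_core (lam c : ℝ) (hl0 : 0 < lam) (hl1 : lam < 1) (hc0 : 1 ≤ (1 + lam) * c) (hc1 : c ≤ 1) :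
    lam * ((1 + lam) * c - 1) ≤ (1 + lam) * c ^ 2 * (3 / 4 - lam * (1 - lam)) := by
  nlinarith [mul_nonneg (sub_nonneg.mpr hc0) (sub_nonneg.mpr hc1), sq_nonneg (c - lam), sq_nonneg (lam - 1 / 2),
    mul_pos hl0 (sub_pos.mpr hl1), sq_nonneg ((1 + lam) * c - 1), mul_nonneg (sub_nonneg.mpr hc0) hl0.le,
    mul_nonneg (mul_nonneg (sub_nonneg.mpr hc0) hl0.le) (sub_pos.mpr hl1).le]

end PocketCert

end Summit.CriticalPhenomena.PercolationContinuityZ3.Theorems
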